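import Summits.Ventures.PercRepro.S1SeriesLeverPlane
import Summits.Ventures.PercRepro.S1CellNineReduced

/-!
# PercRepro — THE ROW-9 CELLS ON THE PLANE-BOUND LEVER: THE CAPS REDUCED ONCE MORE (p2, gen 26; SUBCLAIM-S1 §6.10)

`gbP` (S1SeriesLeverPlane) reads `140` on the coloop-free `19`-point cores of nullity `10` and `72` on the `16`-point
cores of nullity `8`, so `(9, 10)` needs its cap at `t ≥ 18` only (`140 ≤ 140` at `t = 17`) and `(9, 8)` needs its
`16`-point cap at `t ≥ 10` only (`72 ≤ 74` at `t = 9`).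

* **`c025_core_nine_ten_of_cap''`**, **`c025_core_nine_eight_of_caps''`** — the cells with the reduced hypotheses.
Axioms: standard.
-/

open scoped Matroid

namespace PercRepro

namespace S1

open Set

variable {α : Type}

/-- **THE CELL `(9, 10)` MODULO THE CAP AT `t ≥ 18` ONLY**: `gbP 10 19 = 140 = 164 − 8 (17 − 14)`. -/
theorem c025_core_nine_ten_of_cap'' (M : Matroid α) [M.Finite] (hR : M.eRank = (9 : ℕ)) (hn : M.E.ncard = 19)
    (hfree : ∀ e ∈ M.E, ∃ A ⊆ M.E \ {e}, e ∉ M.closure A ∧ e ∉ M.closure ((M.E \ {e}) \ A))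
    (hcap : ∀ (N : Matroid α) [N.Finite],
      (∀ e ∈ N.E, ∃ A ⊆ N.E \ {e}, e ∉ N.closure A ∧ e ∉ N.closure ((N.E \ {e}) \ A)) →
      N.E.encard = N.eRank + ((10 : ℕ) : ℕ∞) → N.E.ncard = 19 → N.coloops = ∅ →
      ∀ t, 18 ≤ t → {C : Set α | N.IsCircuit C ∧ C.ncard = 3}.ncard = t →
      {C : Set α | N.IsCircuit C ∧ C.ncard = 4}.ncard ≤ 164 - 8 * (t - 14)) :
    ThmN.RLS M 9 4 := by
  refine c025_core_nine_ten_of_cap' M hR hn hfree ?_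
  intro N _ hNfree hNd hNn hNcol t ht17 hs
  rcases Nat.lt_or_ge t 18 with h18 | h18
  · have hg := ncard_fourCircuits_le_gbP_of_coloopFree N hNfree hNd hNcol hNn
    have hv : gbP 10 19 = 140 := gbP_values.1
    rw [hv] at hg
    omega
  · exact hcap N hNfree hNd hNn hNcol t h18 hs

/-- **THE CELL `(9, 8)` MODULO THE REDUCED TABLES**: on `17` points at `t ≥ 1`, on `16` points at `t ≥ 10` only
(`gbP 8 16 = 72 ≤ 74 = capNineEight16 9`). -/
theorem c025_core_nine_eight_of_caps'' (M : Matroid α) [M.Finite] (hR : M.eRank = (9 : ℕ)) (hn : M.E.ncard = 17)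
    (hfree : ∀ e ∈ M.E, ∃ A ⊆ M.E \ {e}, e ∉ M.closure A ∧ e ∉ M.closure ((M.E \ {e}) \ A))
    (hcap17 : ∀ (N : Matroid α) [N.Finite],
      (∀ e ∈ N.E, ∃ A ⊆ N.E \ {e}, e ∉ N.closure A ∧ e ∉ N.closure ((N.E \ {e}) \ A)) →
      N.E.encard = N.eRank + ((8 : ℕ) : ℕ∞) → N.E.ncard = 17 → N.coloops = ∅ →
      ∀ t, 1 ≤ t → {C : Set α | N.IsCircuit C ∧ C.ncard = 3}.ncard = t →
      {C : Set α | N.IsCircuit C ∧ C.ncard = 4}.ncard ≤ capNineEight17 t)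
    (hcap16 : ∀ (N : Matroid α) [N.Finite],
      (∀ e ∈ N.E, ∃ A ⊆ N.E \ {e}, e ∉ N.closure A ∧ e ∉ N.closure ((N.E \ {e}) \ A)) →
      N.E.encard = N.eRank + ((8 : ℕ) : ℕ∞) → N.E.ncard = 16 → N.coloops = ∅ →
      ∀ t, 10 ≤ t → {C : Set α | N.IsCircuit C ∧ C.ncard = 3}.ncard = t →
      {C : Set α | N.IsCircuit C ∧ C.ncard = 4}.ncard ≤ capNineEight16 t) :
    ThmN.RLS M 9 4 := by
  refine c025_core_nine_eight_of_caps' M hR hn hfree hcap17 ?_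
  intro N _ hNfree hNd hNn hNcol t ht9 hs
  rcases Nat.lt_or_ge t 10 with h10 | h10
  · have hg := ncard_fourCircuits_le_gbP_of_coloopFree N hNfree hNd hNcol hNn
    have hv : gbP 8 16 = 72 := gbP_values.2.2.2.1
    rw [hv] at hg
    have h9 : t = 9 := by omega
    rw [h9]
    exact hg.trans (by decide)
  · exact hcap16 N hNfree hNd hNn hNcol t h10 hs

end S1

end PercRepro
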